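import Summits.AnomalousDissipation.AnomalousDissipation.Theorems.SolenoidalFractalHomogenisationLagrangianStepSidebandMeanSlot
import Summits.AnomalousDissipation.AnomalousDissipation.Theorems.SolenoidalFractalHomogenisationLagrangianStepSidebandDefsFrame
import HarnessLib

/-!
# K1L_D `LagrangianRenormalisationStepDesign` (stmt-AnomalousDissipation-27980), registered stub `stub_D1_V0thg` (v28, ruling D28-3 (3)), port-map layer L4:
# the FROZEN-FRAME period-mean feedback matrix is a slot integral (helper; `--supports stmt-AnomalousDissipation-27980 --as helper`)

Summits-side helper file of route `SolenoidalFractalHomogenisation` (prover seat `ad-k1l-cellLawV-w1` g9; port map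
`Cruxes/LagrangianRenormalisationStepDesign/Lines/onelevel-vtheta-twist-portmap.md` §3 L4, rulings D28-7 / D28-11).  The frozen-frame twin of `…SidebandMeanSlot` §2–§3:
the feedback functionals and the slot envelopes are flat (REUSED BY NAME: `feedback_comp_eq_zero_of_not_mem_slot`, `slotEnvelope_eq_zero_of_le_start / _of_end_le`);
only the response is twisted (`responseθ`, `IsPeriodicResponseθ`, `meanFeedbackθ` of `…SidebandDefsFrame`).  Everything proved; no definitions, no named facts, no sorry.
* `continuousOn_feedback_comp_frame`, `intervalIntegrable_feedback_comp_frame` — the integrand `t ↦ feedbackⱼ(t)↾ℝ ∘ N t` of a twisted periodic response;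
* **`meanFeedbackθ_eq_slot_integral`** — `meanFeedbackθ W₁ 𝔸 G₀ γ₁ R j j' = (1/P) • ∫_{startⱼ}^{startⱼ+τⱼ} feedbackⱼ(t)↾ℝ ∘ responseθ_{j'}(t) dt` whenever slot `j'`
  has a twisted periodic response (the L6 own-slot Lipschitz road of D28-11 compares these slot integrals frame by frame).
At `G₀ = 1` this is literally `meanFeedback_eq_slot_integral` (`meanFeedbackθ_one`, `responseθ_one`).
NOT a proof of any registered stub, of the crux, or of anomalous dissipation; rung F-D1 infrastructure for the `stub_D1_V0thg` engine.
-/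

set_option linter.dupNamespace false

noncomputable section

namespace Summit.AnomalousDissipation.AnomalousDissipation.Theorems.SolenoidalFractalHomogenisation.LagrangianStep.Sideband

open Set MeasureTheory Complex NormedSpace intervalIntegral
open scoped InnerProductSpace
open Literature.Analysis Literature.Analysis.FunctionSpaces Literature.Analysis.FunctionSpaces.Torus
open Literature.Analysis.FluidPDE Literature.Analysis.FluidPDE.Torus Literature.Analysis.FluidPDE.LatticeShear
open Summit.AnomalousDissipation.AnomalousDissipation.Theorems.SolenoidalFractalHomogenisation.PermissibleCarrier
  (start_nonneg start_add_tau_le_period period_pos)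

variable {k₀ : ℕ}

/-! ## §1 The integrand of the twisted period mean -/

/-- The integrand `t ↦ feedbackⱼ(t)↾ℝ ∘ N t` is continuous on `[0, P]` for a twisted periodic response `N`. [cite: MajdaKramer1999, §2.2.1.3 (55)] -/
theorem continuousOn_feedback_comp_frame (W₁ : LatticeWord k₀) (𝔸 : Torus.Visc4 (Fin 3)) (G₀ : Matrix (Fin 3) (Fin 3) ℝ) (γ₁ : ℝ) (R : ℕ) (j j' : Fin k₀)
    {N : ℝ → (EuclideanSpace ℂ (Fin 3) →L[ℝ] Space R)} (hN : IsPeriodicResponseθ W₁ 𝔸 G₀ γ₁ R j' N) :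
    ContinuousOn (fun t => ((feedback W₁ R j t).restrictScalars ℝ).comp (N t)) (Icc 0 W₁.period) := by
  have hf : Continuous fun t => (feedback W₁ R j t).restrictScalars ℝ :=
    (ContinuousLinearMap.restrictScalarsIsometry ℂ (Space R) (EuclideanSpace ℂ (Fin 3)) ℝ ℝ).continuous.comp (continuous_feedback W₁ R j)
  exact hf.continuousOn.clm_comp hN.1

/-- Hence interval-integrable on every sub-interval of `[0, P]`. [cite: MajdaKramer1999, §2.2.1.3 (55)] -/
theorem intervalIntegrable_feedback_comp_frame (W₁ : LatticeWord k₀) (𝔸 : Torus.Visc4 (Fin 3)) (G₀ : Matrix (Fin 3) (Fin 3) ℝ) (γ₁ : ℝ) (R : ℕ)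
    (j j' : Fin k₀) {N : ℝ → (EuclideanSpace ℂ (Fin 3) →L[ℝ] Space R)} (hN : IsPeriodicResponseθ W₁ 𝔸 G₀ γ₁ R j' N) {a b : ℝ}
    (ha : 0 ≤ a) (hab : a ≤ b) (hb : b ≤ W₁.period) :
    IntervalIntegrable (fun t => ((feedback W₁ R j t).restrictScalars ℝ).comp (N t)) volume a b :=
  ((continuousOn_feedback_comp_frame W₁ 𝔸 G₀ γ₁ R j j' hN).mono (Icc_subset_Icc ha hb)).intervalIntegrable_of_Icc hab

/-! ## §2 The twisted period mean is a slot integral -/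

/-- **`M^θ_{jj'}` IS A SLOT-`j` INTEGRAL.**  If slot `j'` has a twisted periodic response, then
`meanFeedbackθ W₁ 𝔸 G₀ γ₁ R j j' = (1/P) • ∫_{startⱼ}^{startⱼ + τⱼ} feedbackⱼ(t)↾ℝ ∘ responseθ_{j'}(t) dt`. [cite: MajdaKramer1999, §2.2.1.3 (55)] -/
theorem meanFeedbackθ_eq_slot_integral (W₁ : LatticeWord k₀) (𝔸 : Torus.Visc4 (Fin 3)) (G₀ : Matrix (Fin 3) (Fin 3) ℝ) (γ₁ : ℝ) (R : ℕ) (j j' : Fin k₀)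
    (h : ∃ N, IsPeriodicResponseθ W₁ 𝔸 G₀ γ₁ R j' N) :
    meanFeedbackθ W₁ 𝔸 G₀ γ₁ R j j' = (1 / W₁.period) •
      ∫ t in W₁.start j..W₁.start j + (W₁.phase j).τ, ((feedback W₁ R j t).restrictScalars ℝ).comp (responseθ W₁ 𝔸 G₀ γ₁ R j' t) := by
  have hN := isPeriodicResponseθ_responseθ h
  set t₀ := W₁.start j with ht₀
  set t₁ := W₁.start j + (W₁.phase j).τ with ht₁
  have h0 : 0 ≤ t₀ := start_nonneg W₁ j
  have h01 : t₀ ≤ t₁ := by rw [ht₁]; linarith [(W₁.phase j).τ_pos]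
  have h1P : t₁ ≤ W₁.period := start_add_tau_le_period W₁ j
  set F : ℝ → (EuclideanSpace ℂ (Fin 3) →L[ℝ] EuclideanSpace ℂ (Fin 3)) :=
    fun t => ((feedback W₁ R j t).restrictScalars ℝ).comp (responseθ W₁ 𝔸 G₀ γ₁ R j' t) with hF
  have hI1 : IntervalIntegrable F volume 0 t₀ := intervalIntegrable_feedback_comp_frame W₁ 𝔸 G₀ γ₁ R j j' hN le_rfl h0 (h01.trans h1P)
  have hI2 : IntervalIntegrable F volume t₀ t₁ := intervalIntegrable_feedback_comp_frame W₁ 𝔸 G₀ γ₁ R j j' hN h0 h01 h1P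
  have hI3 : IntervalIntegrable F volume t₁ W₁.period := intervalIntegrable_feedback_comp_frame W₁ 𝔸 G₀ γ₁ R j j' hN (h0.trans h01) h1P le_rfl
  have hz1 : ∫ t in (0:ℝ)..t₀, F t = 0 := by
    have hE : EqOn F (fun _ => (0 : EuclideanSpace ℂ (Fin 3) →L[ℝ] EuclideanSpace ℂ (Fin 3))) (uIcc 0 t₀) := by
      intro t ht
      rw [uIcc_of_le h0] at ht
      exact feedback_comp_eq_zero_of_not_mem_slot W₁ R j _ ht.1 (ht.2.trans (h01.trans h1P)) (Or.inl ht.2)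
    rw [intervalIntegral.integral_congr hE, intervalIntegral.integral_zero]
  have hz3 : ∫ t in t₁..W₁.period, F t = 0 := by
    have hE : EqOn F (fun _ => (0 : EuclideanSpace ℂ (Fin 3) →L[ℝ] EuclideanSpace ℂ (Fin 3))) (uIcc t₁ W₁.period) := by
      intro t ht
      rw [uIcc_of_le h1P] at ht
      exact feedback_comp_eq_zero_of_not_mem_slot W₁ R j _ ((h0.trans h01).trans ht.1) ht.2 (Or.inr ht.1)
    rw [intervalIntegral.integral_congr hE, intervalIntegral.integral_zero]
  have hsplit : ∫ t in (0:ℝ)..W₁.period, F t = ∫ t in t₀..t₁, F t := by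
    rw [← intervalIntegral.integral_add_adjacent_intervals hI1 (hI2.trans hI3),
      ← intervalIntegral.integral_add_adjacent_intervals hI2 hI3, hz1, hz3, zero_add, add_zero]
  rw [meanFeedbackθ, hsplit]

end Summit.AnomalousDissipation.AnomalousDissipation.Theorems.SolenoidalFractalHomogenisation.LagrangianStep.Sideband

end
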